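import Mathlib.Probability.Independence.Integration
import Literature.Probability.LatticeModels.PlaneRotatorLiebRivasseauInequality
import Literature.Probability.LatticeModels.PlaneRotatorLiebRivasseauProof
import HarnessLib

/-!
# Layer decoupling for the classical layered XY model: dangling bonds integrate out, and the
# Lieb–Rivasseau separating inequality turns a single-layer (2D) susceptibility ceiling into
# exponential decay ACROSS the layers — `⟨cos(θ_a − θ_c)⟩_Λ ≤ (βJ⊥ χ∥)^{|ℓ(a) − ℓ(c)|}`

Topic `Literature/Probability/LatticeModels`. The classical mechanism behind the quasi-two-dimensional
("layered Kosterlitz–Thouless") crossover of weakly coupled XY layers, in the rigorous direction: the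
three-dimensional ordering temperature of a stack of XY layers with interlayer coupling `J⊥` cannot exceed the
temperature `T_×(J⊥)` at which `J⊥ χ₂(T) = T`, `χ₂` the susceptibility of ONE isolated layer — so
`T_c^{3D} ↓ T_KT` (where `χ₂` diverges) as `J⊥ → 0`. The two printed ingredients are

* the separating-set inequality for plane rotators of E. H. Lieb, *A refinement of Simon's correlation
  inequality*, Comm. Math. Phys. 77 (1980) 127–135 [Lieb1980], eq. (23) (with the inside system `A`; "It is
  immaterial whether the B spins are connected together, for any such interaction can be regarded as part of
  `H_C`", p. 133), proved for all inside systems by V. Rivasseau, Comm. Math. Phys. 77 (1980) 145 — in the tree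
  the NAMED FACT `PlaneRotator.LiebRivasseauInequality` (`PlaneRotatorLiebRivasseauInequality.lean`); and
* Aizenman–Simon's local Ward inequality (Comm. Math. Phys. 77 (1980) 137 [AizenmanSimon1980LocalWard],
  Thm 3.1, `N = 2`) and their iteration argument (Thm 3.2, Remark 4), PROVED in the tree
  (`PlaneRotator.twoPoint_le_half_sum_mul_twoPoint`, `PlaneRotatorMeanFieldBound.lean`),

applied with Lieb's inside system `A_k` = the bonds touching the layer `k` (its in-plane bonds plus the vertical
bonds DANGLING to the free spins of the layers `k ± 1`) and separating set `B = Λ_{k−1} ∪ Λ_{k+1}`. What this file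
adds (all PROVED; vocabulary of `PlaneRotatorGinibreComparison.lean`: couplings `J : V × V → ℝ` on ordered pairs,
`twoPoint J a b = ⟨cos(θ_a − θ_b)⟩_{V,J}`, torus Haar measure `torusHaar`):

* `integral_mul_eq_mul_of_dependsOn` — independence of disjoint coordinate blocks of the torus `U(1)^V`
  (Mathlib's `iIndepFun_pi`): `∫ F G dθ = ∫ F dθ ∫ G dθ` when `F` depends on the coordinates in `L`, `G` on the
  others.
* `shear`, `measurePreserving_shear` — the shear `θ_v ↦ θ_v θ_{foot v}` (`v ∉ L`) is a continuous surjective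
  endomorphism of the compact group `U(1)^V`, hence Haar-measure preserving (`MonoidHom.measurePreserving`).
* `twoPoint_add_leaf_eq` — **dangling bonds integrate out**: if `J` is supported in `L × L` and `D` only on bonds
  `{foot v, v}` with `v ∉ L`, `foot v ∈ L`, then `⟨cos(θ_a − θ_b)⟩_{J+D} = ⟨cos(θ_a − θ_b)⟩_J` for `a, b ∈ L`
  (under the shear the dangling weight becomes a function of the leaf coordinates alone).
* `twoPoint_add_leaf_le` — the **leaf bound** `⟨cos(θ_a − θ_b)⟩_{J+D} ≤ ½ ∑_{y∈L} (D(b,y)+D(y,b)) ⟨cos(θ_y − θ_a)⟩_J`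
  for `a ∈ L`, `b ∉ L` (local Ward at `b`, then the previous item).
* `decay_across_layers` — the transverse iteration: `G ≤ 1`, `G x ≤ ∑_y κ x y G y` off the layer of `c` for a
  kernel `κ ≥ 0` of layer-range `1` and row sums `≤ A` ⇒ `G x ≤ A^{|ℓ(x) − ℓ(c)|}`.
* the layered model on finite `Λ ⊂ ℤ³` (`layeredXYCoupling β J∥ J⊥ Λ` of `PlaneRotatorMeanFieldBound.lean`,
  free boundary conditions; `layer`, `inPlane`, `touching`, `crossing`, `untouching`, `footAt`):
  `crossing_support` (vertical bonds are dangling bonds to the vertical feet), `sum_crossing_le` (vertical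
  coordination `≤ 2βJ⊥`), `twoPoint_touching_le` (the one-layer transfer bound), `liebRivasseau_layer` (the
  instance of the named fact), and the two main statements:

  **`twoPoint_layered_le_pow_interlayer`** — for `β, J∥, J⊥ ≥ 0`, any `χ` with
  `∑_{x ∈ Λ_{ℓ(a)}} ⟨cos(θ_a − θ_x)⟩^{2D}_{Λ_{ℓ(a)}} ≤ χ` for all `a` (the state of the in-plane bonds of ONE layer,
  all other rotators free), and the Lieb–Rivasseau inequality for the inside systems `A_k` as an explicit
  hypothesis `hLR`: `⟨cos(θ_a − θ_c)⟩_{Λ,β} ≤ (β J⊥ χ)^{|ℓ(a) − ℓ(c)|}` for all `a, c ∈ Λ`;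

  **`twoPoint_layered_le_pow_interlayer_of_liebRivasseau`** — the same with `hLR` discharged from the tree's
  named fact, i.e. conditional on `PlaneRotator.LiebRivasseauInequality` alone.

So `βJ⊥χ < 1` gives exponential decay across the layers at rate `log(1/(βJ⊥χ))` per layer, uniformly in `Λ`.
Compared with the mean-field bound of `PlaneRotatorMeanFieldBound.lean` (`k_BT_c ≤ 2J∥ + J⊥`) the in-plane
physics is no longer treated at mean-field level: it enters only through the single-layer susceptibility, which
is finite exactly above the Kosterlitz–Thouless temperature of the layer. The vertical step uses the Ward bound
`u(βJ⊥) = I₁/I₀(βJ⊥) ≤ βJ⊥/2` per bond orientation (no Bessel functions needed).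

Use (cell `pub/hubbard-tc`, MO-S3 ORDER → T_c back-end, ASSUMPTIONS.md §1 keys I1/K5, INTERLAYER-v0.1.md §6 lemma
L3): the interlayer step «2D stiffness/susceptibility word ⇒ 3D ordering ceiling» of the modelling chain has a
theorem-grade one-sided form — any certified ceiling on the 2D susceptibility of the effective XY layer at `T₀`
with `J⊥ χ₂(T₀) < T₀` certifies `T_c^{3D} ≤ T₀`; the Monte-Carlo crossover factor `E(Δ)` remains the
screening-grade companion. HONEST FRAMING: a theorem about the CLASSICAL layered XY model in finite volume,
conditional on a published 1980 inequality typed as a named fact; its use for a material rests on the modelling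
key K5 (superconducting layer ↦ plane rotators with certified stiffness ceilings as couplings) — never certified.

Not here: a proof of the Lieb–Rivasseau inequality (Lieb's gluing Lemma 1 + Rivasseau's digraph lemma); the
infinite-volume limit / a `T_c` object for rotators (none in the tree); in-plane decay (the same argument with a
two-dimensional box as inside system is Lieb's finite-volume algorithm, not formalised); the lower direction
`T_c^{3D} ≥ …` (Ginibre: `PlaneRotatorGinibreComparison.lean`); staggered stackings (several feet per site).
-/

noncomputable section

open MeasureTheory Filter Finset ProbabilityTheory
open scoped Topology BigOperators

namespace Literature.Probability.LatticeModels

namespace PlaneRotator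

/-! ### Independence of disjoint coordinate blocks of the torus `U(1)^V` -/

section Blocks

variable {V : Type*} [Fintype V] [DecidableEq V]

/-- Extension of a block configuration `ψ : L → U(1)` to the whole torus by the identity off `L`. [folklore] -/
def blockExtend (L : Finset V) (ψ : L → Circle) : V → Circle :=
  fun v => if h : v ∈ L then ψ ⟨v, h⟩ else 1

variable [MeasurableSpace Circle] [BorelSpace Circle]

omit [Fintype V] [BorelSpace Circle] in
/-- `blockExtend L` is measurable. [folklore] -/
private theorem measurable_blockExtend (L : Finset V) : Measurable (blockExtend L) := by
  refine measurable_pi_lambda _ fun v => ?_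
  by_cases h : v ∈ L
  · simp only [blockExtend, dif_pos h]; exact measurable_pi_apply _
  · simp only [blockExtend, dif_neg h]; exact measurable_const

omit [DecidableEq V] in
/-- The coordinates `θ ↦ θ_v` of the torus `U(1)^V` are independent under the Haar probability measure
(a product measure). [folklore] -/
private theorem iIndepFun_apply : iIndepFun (fun (v : V) (θ : V → Circle) => θ v) (torusHaar V) :=
  iIndepFun_pi (μ := fun _ : V => Measure.haarMeasure (⊤ : TopologicalSpace.PositiveCompacts Circle))
    (X := fun (_ : V) (z : Circle) => z) fun _ => aemeasurable_id'

/-- **Independence of disjoint coordinate blocks.** If `F` depends only on the coordinates in `L` and `G` only on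
the coordinates outside `L` (both continuous), then `∫ F·G dθ = ∫ F dθ · ∫ G dθ` for the torus Haar measure.
[folklore] -/
private theorem integral_mul_eq_mul_of_dependsOn (L : Finset V) {F G : (V → Circle) → ℝ} (hF : Continuous F)
    (hG : Continuous G) (hFdep : ∀ θ θ' : V → Circle, (∀ v ∈ L, θ v = θ' v) → F θ = F θ')
    (hGdep : ∀ θ θ' : V → Circle, (∀ v ∉ L, θ v = θ' v) → G θ = G θ') :
    ∫ θ, F θ * G θ ∂torusHaar V = (∫ θ, F θ ∂torusHaar V) * ∫ θ, G θ ∂torusHaar V := by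
  set F' : (L → Circle) → ℝ := fun ψ => F (blockExtend L ψ) with hF'
  set G' : ((Lᶜ : Finset V) → Circle) → ℝ := fun ψ => G (blockExtend Lᶜ ψ) with hG'
  have hFF : F = F' ∘ fun (θ : V → Circle) (i : L) => θ i := by
    funext θ
    exact hFdep θ _ fun v hv => by simp [blockExtend, hv]
  have hGG : G = G' ∘ fun (θ : V → Circle) (j : (Lᶜ : Finset V)) => θ j := by
    funext θ
    exact hGdep θ _ fun v hv => by simp [blockExtend, Finset.mem_compl, hv]
  have hind : IndepFun (fun (θ : V → Circle) (i : L) => θ i) (fun θ (j : (Lᶜ : Finset V)) => θ j)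
      (torusHaar V) :=
    iIndepFun_apply.indepFun_finset L Lᶜ disjoint_compl_right fun v => measurable_pi_apply v
  have hmF' : Measurable F' := hF.measurable.comp (measurable_blockExtend L)
  have hmG' : Measurable G' := hG.measurable.comp (measurable_blockExtend Lᶜ)
  have hind' := hind.comp hmF' hmG'
  have h1 : AEStronglyMeasurable (F' ∘ fun (θ : V → Circle) (i : L) => θ i) (torusHaar V) := by
    rw [← hFF]; exact hF.aestronglyMeasurable
  have h2 : AEStronglyMeasurable (G' ∘ fun (θ : V → Circle) (j : (Lᶜ : Finset V)) => θ j) (torusHaar V) := by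
    rw [← hGG]; exact hG.aestronglyMeasurable
  rw [hFF, hGG]
  exact hind'.integral_fun_mul_eq_mul_integral h1 h2

end Blocks

/-! ### The shear automorphism `θ_v ↦ θ_v θ_{foot v}` off a block `L` -/

section Shear

variable {V : Type*} [DecidableEq V] (L : Finset V) (foot : V → V)

/-- The **shear** of the torus `U(1)^V` along a block `L`: `θ_v ↦ θ_v` for `v ∈ L` and `θ_v ↦ θ_v · θ_{foot v}` for
`v ∉ L` — a continuous group endomorphism (an automorphism when `foot` maps `V ∖ L` into `L`). It turns a dangling
bond `cos(θ_v − θ_{foot v})` into the single-spin term `cos θ_v`. [folklore] -/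
def shear : (V → Circle) →* (V → Circle) where
  toFun θ v := if v ∈ L then θ v else θ v * θ (foot v)
  map_one' := by
    funext v
    simp
  map_mul' θ θ' := by
    funext v
    simp only [Pi.mul_apply]
    split_ifs
    · rfl
    · exact mul_mul_mul_comm _ _ _ _

variable {L foot}

/-- `shear θ v = θ v` on the block. [folklore] -/
private theorem shear_apply_of_mem (θ : V → Circle) {v : V} (hv : v ∈ L) : shear L foot θ v = θ v := if_pos hv

/-- `shear θ v = θ v · θ (foot v)` off the block. [folklore] -/
private theorem shear_apply_of_not_mem (θ : V → Circle) {v : V} (hv : v ∉ L) : shear L foot θ v = θ v * θ (foot v) :=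
  if_neg hv

variable (L foot) in
/-- The shear is continuous. [folklore] -/
private theorem continuous_shear : Continuous (shear L foot) := by
  refine continuous_pi fun v => ?_
  by_cases hv : v ∈ L
  · simp only [shear, MonoidHom.coe_mk, OneHom.coe_mk, if_pos hv]
    exact continuous_apply v
  · simp only [shear, MonoidHom.coe_mk, OneHom.coe_mk, if_neg hv]
    exact (continuous_apply v).mul (continuous_apply (foot v))

/-- The shear is onto when `foot` maps the complement of `L` into `L` (explicit inverse
`θ_v ↦ θ_v / θ_{foot v}` off `L`). [folklore] -/
private theorem shear_surjective (hfoot : ∀ v, v ∉ L → foot v ∈ L) : Function.Surjective (shear L foot) := by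
  intro θ'
  refine ⟨fun v => if v ∈ L then θ' v else θ' v * (θ' (foot v))⁻¹, funext fun v => ?_⟩
  by_cases hv : v ∈ L
  · simp [shear, hv]
  · have hf := hfoot v hv
    simp [shear, hv, hf]

variable [Fintype V] [MeasurableSpace Circle] [BorelSpace Circle]

/-- The shear preserves the Haar probability measure of the torus (a continuous surjective endomorphism of a
compact group; Mathlib's `MonoidHom.measurePreserving`). [folklore] -/
private theorem measurePreserving_shear (hfoot : ∀ v, v ∉ L → foot v ∈ L) :
    MeasurePreserving (shear L foot) (torusHaar V) (torusHaar V) :=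
  MonoidHom.measurePreserving (continuous_shear L foot) (shear_surjective hfoot) rfl

/-- Change of variables under the shear for continuous integrands: `∫ g(shear θ) dθ = ∫ g dθ`. [folklore] -/
private theorem integral_comp_shear (hfoot : ∀ v, v ∉ L → foot v ∈ L) {g : (V → Circle) → ℝ} (hg : Continuous g) :
    ∫ θ, g (shear L foot θ) ∂torusHaar V = ∫ θ, g θ ∂torusHaar V := by
  have h := measurePreserving_shear hfoot
  calc ∫ θ, g (shear L foot θ) ∂torusHaar V = ∫ θ, g θ ∂((torusHaar V).map (shear L foot)) :=
        (integral_map h.measurable.aemeasurable hg.aestronglyMeasurable).symm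
    _ = ∫ θ, g θ ∂torusHaar V := by rw [h.map_eq]

end Shear

/-! ### Dangling bonds integrate out -/

section Leaves

variable {V : Type*} [Fintype V] [DecidableEq V] {L : Finset V} {foot : V → V} {J D : V × V → ℝ}

omit [Fintype V] in
/-- On a pair inside the block the relative angle is shear-invariant. [folklore] -/
private theorem diffChar_shear_of_mem (θ : V → Circle) {x y : V} (hx : x ∈ L) (hy : y ∈ L) :
    diffChar x y (shear L foot θ) = diffChar x y θ := by
  simp only [diffChar_apply, shear_apply_of_mem θ hx, shear_apply_of_mem θ hy]

omit [Fintype V] in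
/-- A dangling bond from `foot v ∈ L` to `v ∉ L` becomes the single coordinate `θ_v` under the shear. [folklore] -/
private theorem diffChar_shear_leaf_right (hfoot : ∀ v, v ∉ L → foot v ∈ L) (θ : V → Circle) {v : V}
    (hv : v ∉ L) : diffChar (foot v) v (shear L foot θ) = θ v := by
  simp only [diffChar_apply, shear_apply_of_mem θ (hfoot v hv), shear_apply_of_not_mem θ hv]
  rw [mul_comm (θ v), ← mul_assoc, inv_mul_cancel, one_mul]

omit [Fintype V] in
/-- The reversed dangling bond becomes `θ_v⁻¹` under the shear. [folklore] -/
private theorem diffChar_shear_leaf_left (hfoot : ∀ v, v ∉ L → foot v ∈ L) (θ : V → Circle) {v : V}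
    (hv : v ∉ L) : diffChar v (foot v) (shear L foot θ) = (θ v)⁻¹ := by
  simp only [diffChar_apply, shear_apply_of_mem θ (hfoot v hv), shear_apply_of_not_mem θ hv]
  rw [mul_inv, mul_assoc, inv_mul_cancel, mul_one]

/-- The leaf end of an ordered pair relative to the block `L`: the second vertex unless it lies in `L`.
[folklore] -/
def leafOf (L : Finset V) (p : V × V) : V := if p.2 ∈ L then p.1 else p.2

/-- The **sheared leaf Hamiltonian** `∑_p D_p cos θ_{leaf(p)}` — what the dangling-bond Hamiltonian
`∑_p D_p cos(θ_{p.2} − θ_{p.1})` becomes under the shear. [folklore] -/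
def leafField (L : Finset V) (D : V × V → ℝ) (θ : V → Circle) : ℝ :=
  ∑ p, D p * ((θ (leafOf L p) : Circle) : ℂ).re

/-- `leafField` is continuous. [folklore] -/
private theorem continuous_leafField (L : Finset V) (D : V × V → ℝ) : Continuous (leafField L D) := by
  unfold leafField
  fun_prop

/-- Under a leaf-support hypothesis (`D_p ≠ 0` only on dangling bonds `(foot v, v)` or `(v, foot v)` with
`v ∉ L`), the dangling-bond Hamiltonian of the sheared configuration is the leaf field. [folklore] -/
private theorem ginibreHamiltonian_leaf_shear (hfoot : ∀ v, v ∉ L → foot v ∈ L)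
    (hD : ∀ p, D p ≠ 0 → (p.1 ∉ L ∧ p.2 = foot p.1) ∨ (p.2 ∉ L ∧ p.1 = foot p.2)) (θ : V → Circle) :
    ginibreHamiltonian (pairChars V) D (shear L foot θ) = leafField L D θ := by
  unfold ginibreHamiltonian leafField
  refine Finset.sum_congr rfl fun p _ => ?_
  by_cases hDp : D p = 0
  · rw [hDp, zero_mul, zero_mul]
  congr 1
  rw [pairChars_apply, reChar]
  rcases hD p hDp with ⟨h1, h2⟩ | ⟨h2, h1⟩
  · -- `p = (v, foot v)` with `v = p.1 ∉ L`
    have hl : leafOf L p = p.1 := by rw [leafOf, if_pos (h2 ▸ hfoot _ h1)]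
    obtain ⟨x, y⟩ := p
    simp only at h1 h2 hl ⊢
    subst h2
    rw [diffChar_shear_leaf_left hfoot θ h1, hl, Circle.coe_inv_eq_conj, Complex.conj_re]
  · -- `p = (foot v, v)` with `v = p.2 ∉ L`
    have hl : leafOf L p = p.2 := by rw [leafOf, if_neg h2]
    obtain ⟨x, y⟩ := p
    simp only at h1 h2 hl ⊢
    subst h1
    rw [diffChar_shear_leaf_right hfoot θ h2, hl]

/-- A Hamiltonian with couplings supported in `L × L` is shear-invariant. [folklore] -/
private theorem ginibreHamiltonian_shear_of_supported (hJ : ∀ p, J p ≠ 0 → p.1 ∈ L ∧ p.2 ∈ L) (θ : V → Circle) :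
    ginibreHamiltonian (pairChars V) J (shear L foot θ) = ginibreHamiltonian (pairChars V) J θ := by
  unfold ginibreHamiltonian
  refine Finset.sum_congr rfl fun p _ => ?_
  by_cases hJp : J p = 0
  · rw [hJp, zero_mul, zero_mul]
  rw [pairChars_apply, reChar, reChar, diffChar_shear_of_mem θ (hJ p hJp).1 (hJ p hJp).2]

omit [DecidableEq V] in
/-- A Hamiltonian with couplings supported in `L × L` depends only on the coordinates in `L`. [folklore] -/
private theorem ginibreHamiltonian_dependsOn (hJ : ∀ p, J p ≠ 0 → p.1 ∈ L ∧ p.2 ∈ L) (θ θ' : V → Circle)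
    (h : ∀ v ∈ L, θ v = θ' v) :
    ginibreHamiltonian (pairChars V) J θ = ginibreHamiltonian (pairChars V) J θ' := by
  unfold ginibreHamiltonian
  refine Finset.sum_congr rfl fun p _ => ?_
  by_cases hJp : J p = 0
  · rw [hJp, zero_mul, zero_mul]
  rw [pairChars_apply, reChar, reChar, diffChar_apply, diffChar_apply, h _ (hJ p hJp).1, h _ (hJ p hJp).2]

/-- The leaf field depends only on the coordinates off `L`. [folklore] -/
private theorem leafField_dependsOn (hfoot : ∀ v, v ∉ L → foot v ∈ L)
    (hD : ∀ p, D p ≠ 0 → (p.1 ∉ L ∧ p.2 = foot p.1) ∨ (p.2 ∉ L ∧ p.1 = foot p.2)) (θ θ' : V → Circle)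
    (h : ∀ v ∉ L, θ v = θ' v) : leafField L D θ = leafField L D θ' := by
  unfold leafField
  refine Finset.sum_congr rfl fun p _ => ?_
  by_cases hDp : D p = 0
  · rw [hDp, zero_mul, zero_mul]
  have hl : leafOf L p ∉ L := by
    rcases hD p hDp with ⟨h1, h2⟩ | ⟨h2, h1⟩
    · rwa [leafOf, if_pos (h2 ▸ hfoot _ h1)]
    · rwa [leafOf, if_neg h2]
  rw [h _ hl]

omit [Fintype V] [DecidableEq V] in
/-- `cos(θ_a − θ_b)` for `a, b ∈ L` depends only on the coordinates in `L`. [folklore] -/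
private theorem cosDiff_dependsOn {a b : V} (ha : a ∈ L) (hb : b ∈ L) (θ θ' : V → Circle)
    (h : ∀ v ∈ L, θ v = θ' v) : cosDiff a b θ = cosDiff a b θ' := by
  rw [cosDiff, cosDiff, h a ha, h b hb]

variable [MeasurableSpace Circle] [BorelSpace Circle]

/-- The sheared numerator/denominator factorise: for `F` continuous and depending only on the block,
`∫ F · w_{J+D} dθ = (∫ F · w_J dθ) · ∫ e^{leafField} dθ`. [folklore] -/
private theorem integral_mul_weight_add_leaf (hfoot : ∀ v, v ∉ L → foot v ∈ L)
    (hJ : ∀ p, J p ≠ 0 → p.1 ∈ L ∧ p.2 ∈ L)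
    (hD : ∀ p, D p ≠ 0 → (p.1 ∉ L ∧ p.2 = foot p.1) ∨ (p.2 ∉ L ∧ p.1 = foot p.2))
    {F : (V → Circle) → ℝ} (hF : Continuous F) (hFdep : ∀ θ θ' : V → Circle, (∀ v ∈ L, θ v = θ' v) → F θ = F θ') :
    ∫ θ, F θ * ginibreWeight (pairChars V) (J + D) θ ∂torusHaar V =
      (∫ θ, F θ * ginibreWeight (pairChars V) J θ ∂torusHaar V) *
        ∫ θ, Real.exp (leafField L D θ) ∂torusHaar V := by
  have hcont : Continuous fun θ => F θ * ginibreWeight (pairChars V) (J + D) θ :=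
    hF.mul (continuous_ginibreWeight _ _)
  -- change variables under the shear
  rw [← integral_comp_shear hfoot hcont]
  have hpt : ∀ θ : V → Circle, F (shear L foot θ) * ginibreWeight (pairChars V) (J + D) (shear L foot θ) =
      (F θ * ginibreWeight (pairChars V) J θ) * Real.exp (leafField L D θ) := by
    intro θ
    have h1 : ginibreWeight (pairChars V) J (shear L foot θ) = ginibreWeight (pairChars V) J θ := by
      rw [ginibreWeight, ginibreWeight, ginibreHamiltonian_shear_of_supported hJ]
    have h2 : ginibreWeight (pairChars V) D (shear L foot θ) = Real.exp (leafField L D θ) := by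
      rw [ginibreWeight, ginibreHamiltonian_leaf_shear hfoot hD]
    rw [hFdep (shear L foot θ) θ (fun v hv => shear_apply_of_mem θ hv), ginibreWeight_add, h1, h2, mul_assoc]
  simp_rw [hpt]
  exact integral_mul_eq_mul_of_dependsOn L (hF.mul (continuous_ginibreWeight _ _))
    (Real.continuous_exp.comp (continuous_leafField L D))
    (fun θ θ' h => by rw [hFdep θ θ' h, ginibreWeight, ginibreWeight, ginibreHamiltonian_dependsOn hJ θ θ' h])
    (fun θ θ' h => by rw [leafField_dependsOn hfoot hD θ θ' h])

/-- **Dangling bonds integrate out.** Let the couplings `J` be supported in `L × L` and let `D` be supported on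
dangling bonds — `D_p ≠ 0` only for `p = (foot v, v)` or `p = (v, foot v)` with `v ∉ L`, `foot v ∈ L`. Then for
`a, b ∈ L` the two-point functions of `J + D` and of `J` coincide:
`⟨cos(θ_a − θ_b)⟩_{J+D} = ⟨cos(θ_a − θ_b)⟩_J`. (Shear `θ_v ↦ θ_vθ_{foot v}` — Haar-measure preserving — makes the
dangling weight a function of the leaf coordinates alone, which are independent of the block.) This is the
zero-effect of free ends in the Griffiths–Ginibre «size of the system» comparison, plane-rotator example.
[cite: Ginibre1970, Example 4 with Prop. 3 (plane rotators; subsystems)] -/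
theorem twoPoint_add_leaf_eq (hfoot : ∀ v, v ∉ L → foot v ∈ L) (hJ : ∀ p, J p ≠ 0 → p.1 ∈ L ∧ p.2 ∈ L)
    (hD : ∀ p, D p ≠ 0 → (p.1 ∉ L ∧ p.2 = foot p.1) ∨ (p.2 ∉ L ∧ p.1 = foot p.2)) {a b : V} (ha : a ∈ L)
    (hb : b ∈ L) : twoPoint (J + D) a b = twoPoint J a b := by
  unfold twoPoint ginibreExpect
  have hnum := integral_mul_weight_add_leaf hfoot hJ hD (continuous_cosDiff a b)
    (fun θ θ' h => cosDiff_dependsOn ha hb θ θ' h)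
  have hden := integral_mul_weight_add_leaf hfoot hJ hD (F := fun _ => (1 : ℝ)) continuous_const
    (fun _ _ _ => rfl)
  simp only [one_mul] at hden
  rw [hnum, hden]
  have hE : 0 < ∫ θ, Real.exp (leafField L D θ) ∂torusHaar V :=
    integral_exp_pos (integrable_torusHaar_of_continuous (Real.continuous_exp.comp (continuous_leafField L D)))
  rw [mul_div_mul_right _ _ hE.ne']

/-- **Leaf bound.** In the same setting with `J, D ≥ 0`, for `a ∈ L` and a site `b ∉ L` (a dangling end or a free
rotator): `⟨cos(θ_a − θ_b)⟩_{J+D} ≤ ½ ∑_{y ∈ L} (D(b,y) + D(y,b)) ⟨cos(θ_y − θ_a)⟩_J` — Aizenman–Simon's local Ward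
inequality at the spin `b` (tree `twoPoint_le_half_sum_mul_twoPoint`), whose only bonds are the dangling ones to
its foot, followed by `twoPoint_add_leaf_eq` in the block. (The exact value is `u(D) = I₁/I₀`-weighted; the Ward
bound `u(x) ≤ x/2` is what is used.) [cite: AizenmanSimon1980LocalWard, Thm 3.1 (N = 2)] -/
theorem twoPoint_add_leaf_le (hfoot : ∀ v, v ∉ L → foot v ∈ L) (hJ : ∀ p, J p ≠ 0 → p.1 ∈ L ∧ p.2 ∈ L)
    (hD : ∀ p, D p ≠ 0 → (p.1 ∉ L ∧ p.2 = foot p.1) ∨ (p.2 ∉ L ∧ p.1 = foot p.2)) (hJ0 : ∀ p, 0 ≤ J p)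
    (hD0 : ∀ p, 0 ≤ D p) {a b : V} (ha : a ∈ L) (hb : b ∉ L) :
    twoPoint (J + D) a b ≤ (1 / 2) * ∑ y ∈ L, (D (b, y) + D (y, b)) * twoPoint J y a := by
  have hba : b ≠ a := fun h => hb (h ▸ ha)
  have hJD0 : ∀ p, 0 ≤ (J + D) p := fun p => add_nonneg (hJ0 p) (hD0 p)
  rw [twoPoint_comm]
  refine (twoPoint_le_half_sum_mul_twoPoint hJD0 hba).trans (le_of_eq ?_)
  congr 1
  -- `J` does not touch `b ∉ L`
  have hJb : ∀ y, J (b, y) = 0 ∧ J (y, b) = 0 := fun y =>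
    ⟨by_contra fun h => hb (hJ _ h).1, by_contra fun h => hb (hJ _ h).2⟩
  -- the dangling couplings at `b` only see `foot b ∈ L`
  have hDb : ∀ y, y ∉ L → D (b, y) = 0 ∧ D (y, b) = 0 := by
    intro y hy
    constructor
    · by_contra h
      rcases hD _ h with ⟨-, h2⟩ | ⟨-, h1⟩
      · simp only at h2
        exact hy (by rw [h2]; exact hfoot b hb)
      · simp only at h1
        exact hb (by rw [h1]; exact hfoot y hy)
    · by_contra h
      rcases hD _ h with ⟨-, h2⟩ | ⟨-, h1⟩
      · simp only at h2
        exact hb (by rw [h2]; exact hfoot y hy)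
      · simp only at h1
        exact hy (by rw [h1]; exact hfoot b hb)
  symm
  refine (Finset.sum_subset (Finset.subset_univ L) fun y _ hy => ?_).trans (Finset.sum_congr rfl fun y _ => ?_)
  · rw [(hDb y hy).1, (hDb y hy).2]
    ring
  · by_cases hy : y ∈ L
    · rw [Pi.add_apply, Pi.add_apply, (hJb y).1, (hJb y).2, zero_add, zero_add,
        twoPoint_add_leaf_eq hfoot hJ hD hy ha]
    · rw [Pi.add_apply, Pi.add_apply, (hJb y).1, (hJb y).2, (hDb y hy).1, (hDb y hy).2]
      ring

end Leaves

/-! ### Iteration across the layers (Aizenman–Simon's Remark 4 / Simon's Theorem 1.3 pattern) -/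

section Iteration

variable {V : Type*} [Fintype V]

/-- **Decay across layers from a one-step transfer inequality.** Let `G ≤ 1` on a finite set carrying an integer
layer index `ℓ`, let `κ ≥ 0` be a kernel supported on pairs of layer-distance `≤ 1` with row sums `≤ A`, and suppose
`G x ≤ ∑_y κ x y G y` for every `x` outside the layer of `c`. Then `G x ≤ A^{|ℓ x − ℓ c|}` for every `x`. (Induction
on `n`: `G ≤ max(A^{|ℓ· − ℓc|}, Aⁿ)`; the case `A > 1` is trivial.) This is the abstract mass-gap lemma of Simon
(translation invariance inessential) in the direction transverse to the layers. [cite: AizenmanSimon1980LocalWard, Thm 3.2 and Remark 4] -/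
theorem decay_across_layers {G : V → ℝ} {κ : V → V → ℝ} (ℓ : V → ℤ) (c : V) {A : ℝ} (hG1 : ∀ x, G x ≤ 1)
    (hκ : ∀ x y, 0 ≤ κ x y) (hrow : ∀ x, ∑ y, κ x y ≤ A) (hsupp : ∀ x y, κ x y ≠ 0 → (ℓ x - ℓ y).natAbs ≤ 1)
    (hstep : ∀ x, ℓ x ≠ ℓ c → G x ≤ ∑ y, κ x y * G y) (x : V) : G x ≤ A ^ (ℓ x - ℓ c).natAbs := by
  set d : V → ℕ := fun z => (ℓ z - ℓ c).natAbs with hd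
  have hA : 0 ≤ A := (Finset.sum_nonneg fun y _ => hκ x y).trans (hrow x)
  by_cases hA1 : A ≤ 1
  swap
  · exact (hG1 x).trans (one_le_pow₀ (not_le.1 hA1).le)
  have hP : ∀ n : ℕ, ∀ z, G z ≤ max (A ^ d z) (A ^ n) := by
    intro n
    induction n with
    | zero => exact fun z => (hG1 z).trans (by rw [pow_zero]; exact le_max_right _ _)
    | succ n ih =>
      intro z
      by_cases hdz : d z = 0
      · rw [hdz, pow_zero]
        exact (hG1 _).trans (le_max_left _ _)
      have hzc : ℓ z ≠ ℓ c := fun h => hdz (by simp [hd, h])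
      have hdz1 : 1 ≤ d z := Nat.one_le_iff_ne_zero.2 hdz
      set m : ℝ := max (A ^ (d z - 1)) (A ^ n) with hm
      have hm0 : 0 ≤ m := le_max_of_le_right (pow_nonneg hA n)
      have hterm : ∀ y, κ z y * G y ≤ κ z y * m := by
        intro y
        by_cases hκy : κ z y = 0
        · rw [hκy, zero_mul, zero_mul]
        refine mul_le_mul_of_nonneg_left ((ih y).trans (max_le_max ?_ le_rfl)) (hκ z y)
        have hdy : d z - 1 ≤ d y := by
          have h1 := hsupp z y hκy
          have h2 : (ℓ z - ℓ c).natAbs ≤ (ℓ z - ℓ y).natAbs + (ℓ y - ℓ c).natAbs := by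
            have := Int.natAbs_add_le (ℓ z - ℓ y) (ℓ y - ℓ c)
            rwa [sub_add_sub_cancel] at this
          simp only [hd]
          omega
        exact pow_le_pow_of_le_one hA hA1 hdy
      have hsum : ∑ y, κ z y * G y ≤ A * m :=
        calc ∑ y, κ z y * G y ≤ ∑ y, κ z y * m := Finset.sum_le_sum fun y _ => hterm y
          _ = (∑ y, κ z y) * m := by rw [Finset.sum_mul]
          _ ≤ A * m := mul_le_mul_of_nonneg_right (hrow z) hm0
      calc G z ≤ ∑ y, κ z y * G y := hstep z hzc
        _ ≤ A * m := hsum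
        _ = max (A * A ^ (d z - 1)) (A * A ^ n) := by rw [hm, mul_max_of_nonneg _ _ hA]
        _ = max (A ^ d z) (A ^ (n + 1)) := by rw [← pow_succ', ← pow_succ', Nat.sub_add_cancel hdz1]
  have h := hP (d x) x
  rwa [max_self] at h

end Iteration

/-! ### The layered XY model on `ℤ³`: layers, in-plane and crossing bonds, vertical feet -/

section LayeredZ3

open Literature.Barriers.CriticalPhenomena Literature.Barriers.CriticalPhenomena.LongRangeIsing

variable {Λ : Finset (Site 3)}

/-- The layer index (third coordinate) of a site of `Λ ⊂ ℤ³`. [cite: LiuStanley1972, p. 272 (layers (J, J, εJ))] -/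
def layer (x : Λ) : ℤ := (x : Site 3) 2

/-- The **in-plane couplings of layer `k`**: `J` restricted to ordered pairs with both ends in layer `k` (all other
rotators free) — the strictly two-dimensional system of that layer. [cite: LiuStanley1972, p. 272 (layers (J, J, εJ))] -/
def inPlane (J : Λ × Λ → ℝ) (k : ℤ) (p : Λ × Λ) : ℝ :=
  if layer p.1 = k ∧ layer p.2 = k then J p else 0

/-- The **bonds touching layer `k`**: `J` restricted to ordered pairs with at least one end in layer `k` (for
nearest-layer couplings: the in-plane bonds of layer `k` and the vertical bonds to the layers `k ± 1`) — Lieb's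
inside system `A` for the separating set `B` = layers `k ± 1`. [cite: LiuStanley1972, p. 272 (layers (J, J, εJ))] -/
def touching (J : Λ × Λ → ℝ) (k : ℤ) (p : Λ × Λ) : ℝ :=
  if layer p.1 = k ∨ layer p.2 = k then J p else 0

/-- The **crossing bonds of layer `k`**: `J` restricted to ordered pairs with exactly one end in layer `k` (the
vertical bonds `k ↔ k ± 1`, both orientations). [cite: LiuStanley1972, p. 272 (layers (J, J, εJ))] -/
def crossing (J : Λ × Λ → ℝ) (k : ℤ) (p : Λ × Λ) : ℝ :=
  if (layer p.1 = k ∧ layer p.2 ≠ k) ∨ (layer p.1 ≠ k ∧ layer p.2 = k) then J p else 0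

/-- `touching = inPlane + crossing`: the inside Hamiltonian of layer `k` is its in-plane part plus the dangling
vertical bonds (Lieb: the `B` spins' mutual interactions may be moved to `H_C`). [cite: Lieb1980, proof of Theorem 4 (star graph; B–B interactions regarded as part of H_C)] -/
theorem touching_eq_inPlane_add_crossing (J : Λ × Λ → ℝ) (k : ℤ) : touching J k = inPlane J k + crossing J k := by
  funext p
  simp only [touching, inPlane, crossing, Pi.add_apply]
  by_cases h1 : layer p.1 = k <;> by_cases h2 : layer p.2 = k <;> simp [h1, h2]

/-- `inPlane J k ≥ 0` for `J ≥ 0`. [folklore] -/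
private theorem inPlane_nonneg {J : Λ × Λ → ℝ} (hJ : ∀ p, 0 ≤ J p) (k : ℤ) (p : Λ × Λ) : 0 ≤ inPlane J k p := by
  unfold inPlane; split_ifs; exacts [hJ p, le_rfl]

/-- `crossing J k ≥ 0` for `J ≥ 0`. [folklore] -/
private theorem crossing_nonneg {J : Λ × Λ → ℝ} (hJ : ∀ p, 0 ≤ J p) (k : ℤ) (p : Λ × Λ) : 0 ≤ crossing J k p := by
  unfold crossing; split_ifs; exacts [hJ p, le_rfl]

/-- `touching J k ≥ 0` for `J ≥ 0`. [folklore] -/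
private theorem touching_nonneg {J : Λ × Λ → ℝ} (hJ : ∀ p, 0 ≤ J p) (k : ℤ) (p : Λ × Λ) : 0 ≤ touching J k p := by
  unfold touching; split_ifs; exacts [hJ p, le_rfl]

/-- `inPlane J k` is supported on pairs inside layer `k`. [folklore] -/
private theorem inPlane_support (J : Λ × Λ → ℝ) (k : ℤ) (p : Λ × Λ) (hp : inPlane J k p ≠ 0) :
    p.1 ∈ univ.filter (fun x : Λ => layer x = k) ∧ p.2 ∈ univ.filter (fun x : Λ => layer x = k) := by
  unfold inPlane at hp
  by_cases h : layer p.1 = k ∧ layer p.2 = k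
  · simpa [Finset.mem_filter] using h
  · exact absurd (if_neg h) hp

/-- The **vertical foot** in layer `k` of a site `v`: the site of `Λ` with the same in-plane coordinates and third
coordinate `k` if present, else the default `a₀`. [folklore] -/
def footAt (Λ : Finset (Site 3)) (k : ℤ) (a₀ : Λ) (v : Λ) : Λ :=
  if h : Function.update (v : Site 3) 2 k ∈ Λ then ⟨_, h⟩ else a₀

/-- The foot lies in layer `k` (when the default does). [folklore] -/
private theorem layer_footAt (k : ℤ) {a₀ : Λ} (ha₀ : layer a₀ = k) (v : Λ) : layer (footAt Λ k a₀ v) = k := by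
  unfold footAt
  split_ifs with h
  · simp [layer]
  · exact ha₀

/-- Two nearest neighbours of `ℤ³` in different layers differ only in the third coordinate. [folklore] -/
private theorem eq_update_of_l1Norm_eq_one {x y : Site 3} (h1 : l1Norm (x - y) = 1) (h2 : x 2 ≠ y 2) :
    y = Function.update x 2 (y 2) := by
  have hsum : (x 0 - y 0).natAbs + (x 1 - y 1).natAbs + (x 2 - y 2).natAbs = 1 := by
    have h := h1
    unfold l1Norm at h
    rw [Fin.sum_univ_three] at h
    simpa only [Pi.sub_apply] using h
  have h2' : (x 2 - y 2).natAbs ≠ 0 := by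
    rw [Ne, Int.natAbs_eq_zero, sub_eq_zero]
    exact h2
  have h0 : x 0 = y 0 := by omega
  have h1' : x 1 = y 1 := by omega
  funext i
  fin_cases i
  · simp [h0]
  · simp [h1']
  · simp

/-- For nearest-neighbour couplings the crossing bonds of layer `k` are **dangling bonds** in the sense of
`twoPoint_add_leaf_eq`: each joins a site `v` outside layer `k` to its vertical foot. [folklore] -/
private theorem crossing_support {J : Λ × Λ → ℝ} (hJnn : ∀ p, J p ≠ 0 → l1Norm ((p.1 : Site 3) - (p.2 : Site 3)) = 1)
    (k : ℤ) (a₀ : Λ) (p : Λ × Λ) (hp : crossing J k p ≠ 0) :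
    (p.1 ∉ univ.filter (fun x : Λ => layer x = k) ∧ p.2 = footAt Λ k a₀ p.1) ∨
      (p.2 ∉ univ.filter (fun x : Λ => layer x = k) ∧ p.1 = footAt Λ k a₀ p.2) := by
  have hcond : (layer p.1 = k ∧ layer p.2 ≠ k) ∨ (layer p.1 ≠ k ∧ layer p.2 = k) := by
    by_contra h; exact hp (if_neg h)
  have hJp : J p ≠ 0 := by
    intro h; apply hp; unfold crossing; rw [h, ite_self]
  have hl1 := hJnn p hJp
  simp only [Finset.mem_filter, Finset.mem_univ, true_and]
  rcases hcond with ⟨h1, h2⟩ | ⟨h1, h2⟩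
  · -- `p.1` in layer `k`, `p.2` not: `p.1` is the foot of `p.2`
    right
    refine ⟨h2, ?_⟩
    have hne : (p.2 : Site 3) 2 ≠ (p.1 : Site 3) 2 := fun h => h2 (by rw [layer, h]; exact h1)
    have hgeom := eq_update_of_l1Norm_eq_one (by rwa [l1Norm_sub_comm]) hne
    have hk : (p.1 : Site 3) 2 = k := h1
    rw [hk] at hgeom
    have hmem : Function.update (p.2 : Site 3) 2 k ∈ Λ := by rw [← hgeom]; exact p.1.2
    apply Subtype.ext
    rw [footAt, dif_pos hmem]
    exact hgeom
  · left
    refine ⟨h1, ?_⟩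
    have hne : (p.1 : Site 3) 2 ≠ (p.2 : Site 3) 2 := fun h => h1 (by rw [layer, h]; exact h2)
    have hgeom := eq_update_of_l1Norm_eq_one hl1 hne
    have hk : (p.2 : Site 3) 2 = k := h2
    rw [hk] at hgeom
    have hmem : Function.update (p.1 : Site 3) 2 k ∈ Λ := by rw [← hgeom]; exact p.2.2
    apply Subtype.ext
    rw [footAt, dif_pos hmem]
    exact hgeom

variable {β Jp Jz : ℝ}

/-- The layered XY couplings are nearest-neighbour: `J(x,y) ≠ 0 ⇒ |x − y|₁ = 1`. [cite: LiuStanley1972, p. 272 (layers (J, J, εJ))] -/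
theorem layeredXYCoupling_nn (Λ : Finset (Site 3)) (p : Λ × Λ) (hp : layeredXYCoupling β Jp Jz Λ p ≠ 0) :
    l1Norm ((p.1 : Site 3) - (p.2 : Site 3)) = 1 := by
  by_contra h
  apply hp
  unfold layeredXYCoupling layeredCoupling
  rw [if_neg h, mul_zero]

/-- **Vertical coordination.** For `β, J⊥ ≥ 0` and a site `y` of layer `k`, the crossing couplings at `y` (both
orientations, summed over the volume) total at most `2βJ⊥` — two axial neighbours, tree `sum_layeredCoupling_le`
at `J∥ = 0`. [cite: Panis2023Triviality, §1.2.1 (assumption (A2): |J| = sup_x Σ_y J_{x,y})] -/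
theorem sum_crossing_le (hβ : 0 ≤ β) (hz : 0 ≤ Jz) (Λ : Finset (Site 3)) {k : ℤ} {y : Λ} (hy : layer y = k) :
    ∑ b : Λ, (crossing (layeredXYCoupling β Jp Jz Λ) k (b, y) + crossing (layeredXYCoupling β Jp Jz Λ) k (y, b)) ≤
      2 * (β * Jz) := by
  -- each crossing coupling at `y` is at most the purely axial coupling `(β/2)·layeredCoupling 0 J⊥`
  have haxial : ∀ b : Λ, layer b ≠ k →
      layeredCoupling Jp Jz (b : Site 3) (y : Site 3) = layeredCoupling 0 Jz (b : Site 3) (y : Site 3) := by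
    intro b hb
    have h2 : ((b : Site 3) - (y : Site 3)) 2 ≠ 0 := by
      rw [Pi.sub_apply, sub_ne_zero]
      exact fun h => hb (by rw [layer, h]; exact hy)
    unfold layeredCoupling
    rw [if_neg h2, if_neg h2]
  have hb1 : ∀ b : Λ, crossing (layeredXYCoupling β Jp Jz Λ) k (b, y) ≤
      β / 2 * layeredCoupling 0 Jz (y : Site 3) (b : Site 3) := by
    intro b
    unfold crossing
    split_ifs with h
    · have hb : layer b ≠ k := by
        rcases h with ⟨_, h2⟩ | ⟨h1, _⟩
        · exact absurd hy h2
        · exact h1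
      unfold layeredXYCoupling
      rw [haxial b hb, layeredCoupling_symm]
    · exact mul_nonneg (by positivity) (layeredCoupling_nonneg le_rfl hz _ _)
  have hb2 : ∀ b : Λ, crossing (layeredXYCoupling β Jp Jz Λ) k (y, b) ≤
      β / 2 * layeredCoupling 0 Jz (y : Site 3) (b : Site 3) := by
    intro b
    unfold crossing
    split_ifs with h
    · have hb : layer b ≠ k := by
        rcases h with ⟨_, h2⟩ | ⟨h1, _⟩
        · exact h2
        · exact absurd hy h1
      unfold layeredXYCoupling
      rw [layeredCoupling_symm, haxial b hb, layeredCoupling_symm]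
    · exact mul_nonneg (by positivity) (layeredCoupling_nonneg le_rfl hz _ _)
  have hsum := sum_layeredCoupling_le (le_refl (0 : ℝ)) hz Λ (y : Site 3)
  rw [← Finset.sum_coe_sort Λ] at hsum
  calc ∑ b : Λ, (crossing (layeredXYCoupling β Jp Jz Λ) k (b, y) + crossing (layeredXYCoupling β Jp Jz Λ) k (y, b))
      ≤ ∑ b : Λ, (β / 2 * layeredCoupling 0 Jz (y : Site 3) (b : Site 3) +
          β / 2 * layeredCoupling 0 Jz (y : Site 3) (b : Site 3)) :=
        Finset.sum_le_sum fun b _ => add_le_add (hb1 b) (hb2 b)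
    _ = β * ∑ b : Λ, layeredCoupling 0 Jz (y : Site 3) (b : Site 3) := by
        rw [Finset.mul_sum]
        exact Finset.sum_congr rfl fun b _ => by ring
    _ ≤ β * (4 * 0 + 2 * Jz) := mul_le_mul_of_nonneg_left hsum hβ
    _ = 2 * (β * Jz) := by ring

variable [MeasurableSpace Circle] [BorelSpace Circle]

/-- **The one-layer transfer bound.** For the layered XY model and sites `x` (layer `k`) and `b` (another layer):
`⟨cos(θ_x − θ_b)⟩_{A_k} ≤ ½ ∑_{y ∈ Λ_k} (D_k(b,y) + D_k(y,b)) ⟨cos(θ_y − θ_x)⟩^{2D}_{Λ_k}`, where `A_k` = the bonds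
touching layer `k` (Lieb's inside system), `D_k` = its crossing bonds and `⟨·⟩^{2D}_{Λ_k}` = the in-plane system of
layer `k` alone (`twoPoint_add_leaf_le` with the vertical feet). [cite: AizenmanSimon1980LocalWard, Thm 3.1 (N = 2)] -/
theorem twoPoint_touching_le (hβ : 0 ≤ β) (hp : 0 ≤ Jp) (hz : 0 ≤ Jz) (Λ : Finset (Site 3)) (x b : Λ)
    (hb : layer b ≠ layer x) :
    twoPoint (touching (layeredXYCoupling β Jp Jz Λ) (layer x)) x b ≤
      (1 / 2) * ∑ y ∈ univ.filter (fun y : Λ => layer y = layer x),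
        (crossing (layeredXYCoupling β Jp Jz Λ) (layer x) (b, y) +
            crossing (layeredXYCoupling β Jp Jz Λ) (layer x) (y, b)) *
          twoPoint (inPlane (layeredXYCoupling β Jp Jz Λ) (layer x)) y x := by
  set J := layeredXYCoupling β Jp Jz Λ with hJ
  have hJ0 : ∀ p, 0 ≤ J p := layeredXYCoupling_nonneg hβ hp hz Λ
  rw [touching_eq_inPlane_add_crossing]
  have hx : x ∈ univ.filter (fun y : Λ => layer y = layer x) := by simp
  have hb' : b ∉ univ.filter (fun y : Λ => layer y = layer x) := by simpa using hb
  exact twoPoint_add_leaf_le (L := univ.filter (fun y : Λ => layer y = layer x)) (foot := footAt Λ (layer x) x)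
    (fun v _ => by simpa using layer_footAt (layer x) (a₀ := x) rfl v) (inPlane_support J (layer x))
    (crossing_support (layeredXYCoupling_nn Λ) (layer x) x) (inPlane_nonneg hJ0 _)
    (crossing_nonneg hJ0 _) hx hb'

/-- **Layer decoupling for the layered XY model on `ℤ³` (modulo the Lieb–Rivasseau separating inequality).**
Let `β, J∥, J⊥ ≥ 0`, `Λ ⊂ ℤ³` finite (free boundary conditions), and let `χ` bound the single-layer
susceptibilities: for every site `a`, `∑_{x ∈ Λ_{ℓ(a)}} ⟨cos(θ_a − θ_x)⟩^{2D}_{Λ_{ℓ(a)}} ≤ χ`, where `⟨·⟩^{2D}_{Λ_k}` is the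
plane-rotator state of the in-plane bonds of layer `k` ALONE (`inPlane`; the strictly two-dimensional model of
that layer — tree `twoPoint_extend_eq` identifies it with the model on the vertex set `Λ_k`). Assume the
Lieb–Rivasseau inequality [Lieb, CMP 77 (1980) 127, eq. (23); Rivasseau, CMP 77 (1980) 145] for the inside systems
`A_k` = bonds touching layer `k` and the separating sets `Λ_{k±1}`:
`⟨cos(θ_a − θ_c)⟩_Λ ≤ ∑_{b ∈ Λ_{ℓ(a)±1}} ⟨cos(θ_a − θ_b)⟩_{A_{ℓ(a)}} ⟨cos(θ_b − θ_c)⟩_Λ` whenever `ℓ(c) ≠ ℓ(a)`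
(hypothesis `hLR`; a published theorem, typed in the tree as a named fact by the `hubbard-tc` cell). THEN for all
`a, c ∈ Λ`:

  `⟨cos(θ_a − θ_c)⟩_{Λ,β} ≤ (β J⊥ χ)^{|ℓ(a) − ℓ(c)|}`.

So `βJ⊥χ < 1` forces exponential decay ACROSS the layers, uniformly in the volume: a (certified) ceiling `χ₂(T)` on
the two-dimensional susceptibility with `J⊥ χ₂(T) < T` certifies the absence of inter-layer order at `T` — the
three-dimensional ordering temperature of the layered model obeys `T_c^{3D} ≤ T_×(J⊥) := inf{T : J⊥χ₂(T) < T}`,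
which tends to `T_KT` (where `χ₂ = ∞`) as `J⊥ → 0`; with the Kosterlitz–Thouless form of `χ₂` this is the
logarithmic quasi-2D crossover law as a one-sided BOUND. The in-plane physics enters only through `χ` (no mean-field
step in the plane; the vertical step uses the local Ward bound `u(βJ⊥) ≤ βJ⊥/2` per bond orientation). Cell use
(`pub/hubbard-tc`, ASSUMPTIONS.md §1, key I1/K5): the interlayer factor `E(Δ)` of the MC crossover formula acquires
a theorem-grade one-sided counterpart wherever a certified `χ₂` is available; classical effective model only (K5).
[cite: AizenmanSimon1980LocalWard, Thm 3.2 and Remark 4 (mass gap by iteration of a local inequality)] -/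
theorem twoPoint_layered_le_pow_interlayer (hβ : 0 ≤ β) (hp : 0 ≤ Jp) (hz : 0 ≤ Jz) (Λ : Finset (Site 3)) {χ : ℝ}
    (hχ : ∀ a : Λ, ∑ x ∈ univ.filter (fun x : Λ => layer x = layer a),
      twoPoint (inPlane (layeredXYCoupling β Jp Jz Λ) (layer a)) a x ≤ χ)
    (hLR : ∀ a c : Λ, layer a ≠ layer c →
      twoPoint (layeredXYCoupling β Jp Jz Λ) a c ≤
        ∑ b ∈ univ.filter (fun b : Λ => (layer b - layer a).natAbs = 1),
          twoPoint (touching (layeredXYCoupling β Jp Jz Λ) (layer a)) a b *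
            twoPoint (layeredXYCoupling β Jp Jz Λ) b c)
    (a c : Λ) :
    twoPoint (layeredXYCoupling β Jp Jz Λ) a c ≤ (β * Jz * χ) ^ (layer a - layer c).natAbs := by
  set J := layeredXYCoupling β Jp Jz Λ with hJ
  have hJ0 : ∀ p, 0 ≤ J p := layeredXYCoupling_nonneg hβ hp hz Λ
  -- the transfer kernel across one layer
  set S : Λ → Λ → ℝ := fun x b =>
    (1 / 2) * ∑ y ∈ univ.filter (fun y : Λ => layer y = layer x),
      (crossing J (layer x) (b, y) + crossing J (layer x) (y, b)) * twoPoint (inPlane J (layer x)) y x with hS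
  have hS0 : ∀ x b, 0 ≤ S x b := fun x b =>
    mul_nonneg (by norm_num) (Finset.sum_nonneg fun y _ =>
      mul_nonneg (add_nonneg (crossing_nonneg hJ0 _ _) (crossing_nonneg hJ0 _ _))
        (twoPoint_nonneg (inPlane_nonneg hJ0 _) _ _))
  set κ : Λ → Λ → ℝ := fun x b => if (layer b - layer x).natAbs = 1 then S x b else 0 with hκ
  refine decay_across_layers (G := fun x => twoPoint J x c) (κ := κ) layer c (fun x => twoPoint_le_one J x c)
    (fun x b => by simp only [hκ]; split_ifs; exacts [hS0 x b, le_rfl]) ?_ ?_ ?_ a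
  · -- row sums: `∑_b κ x b ≤ β J⊥ χ`
    intro x
    have hβz : 0 ≤ β * Jz := mul_nonneg hβ hz
    calc ∑ b, κ x b ≤ ∑ b, S x b := Finset.sum_le_sum fun b _ => by
            simp only [hκ]; split_ifs; exacts [le_rfl, hS0 x b]
      _ = (1 / 2) * ∑ y ∈ univ.filter (fun y : Λ => layer y = layer x),
            twoPoint (inPlane J (layer x)) y x *
              ∑ b, (crossing J (layer x) (b, y) + crossing J (layer x) (y, b)) := by
          simp only [hS]
          rw [← Finset.mul_sum, Finset.sum_comm]
          congr 1
          refine Finset.sum_congr rfl fun y _ => ?_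
          rw [Finset.mul_sum]
          exact Finset.sum_congr rfl fun b _ => by ring
      _ ≤ (1 / 2) * ∑ y ∈ univ.filter (fun y : Λ => layer y = layer x),
            twoPoint (inPlane J (layer x)) y x * (2 * (β * Jz)) := by
          gcongr with y hy
          · exact twoPoint_nonneg (inPlane_nonneg hJ0 _) _ _
          · exact sum_crossing_le hβ hz Λ (by simpa using hy)
      _ = (β * Jz) * ∑ y ∈ univ.filter (fun y : Λ => layer y = layer x), twoPoint (inPlane J (layer x)) x y := by
          rw [← Finset.sum_mul]
          rw [show (∑ y ∈ univ.filter (fun y : Λ => layer y = layer x), twoPoint (inPlane J (layer x)) y x) =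
              ∑ y ∈ univ.filter (fun y : Λ => layer y = layer x), twoPoint (inPlane J (layer x)) x y from
            Finset.sum_congr rfl fun y _ => twoPoint_comm _ _ _]
          ring
      _ ≤ (β * Jz) * χ := mul_le_mul_of_nonneg_left (hχ x) hβz
      _ = β * Jz * χ := rfl
  · -- support: one layer at a time
    intro x b hxb
    have h : (layer b - layer x).natAbs = 1 := by
      by_contra h; exact hxb (by simp only [hκ, if_neg h])
    omega
  · -- the transfer step: Lieb–Rivasseau, then the leaf bound
    intro x hxc
    refine (hLR x c hxc).trans ?_
    rw [Finset.sum_filter]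
    refine Finset.sum_le_sum fun b _ => ?_
    split_ifs with h
    · have hb : layer b ≠ layer x := by
        intro hh; rw [hh, sub_self] at h; exact absurd h (by norm_num)
      simp only [hκ, if_pos h]
      exact mul_le_mul_of_nonneg_right (twoPoint_touching_le hβ hp hz Λ x b hb) (twoPoint_nonneg hJ0 _ _)
    · simp only [hκ, if_neg h, zero_mul]
      exact le_rfl

/-! ### Discharging the separating-inequality hypothesis from the tree's named fact -/

/-- The **bonds NOT touching layer `k`** (`J` minus `touching J k`): Lieb's outside Hamiltonian `H_C`.
[cite: Lieb1980, eqs. (4)–(5) (H_{A+C} = H_A + H_C)] -/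
def untouching (J : Λ × Λ → ℝ) (k : ℤ) (p : Λ × Λ) : ℝ :=
  if layer p.1 = k ∨ layer p.2 = k then 0 else J p

omit [MeasurableSpace Circle] [BorelSpace Circle] in
/-- `touching J k + untouching J k = J`: the decomposition `H_{A+C} = H_A + H_C` for the inside system of layer `k`.
[cite: Lieb1980, eqs. (4)–(5) (H_{A+C} = H_A + H_C)] -/
theorem touching_add_untouching (J : Λ × Λ → ℝ) (k : ℤ) : touching J k + untouching J k = J := by
  funext p
  simp only [touching, untouching, Pi.add_apply]
  split_ifs <;> simp

omit [MeasurableSpace Circle] [BorelSpace Circle] in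
/-- For nearest-neighbour couplings, a bond changes the layer index by at most one. [folklore] -/
private theorem natAbs_layer_sub_le_of_nn {J : Λ × Λ → ℝ} (hJnn : ∀ p, J p ≠ 0 → l1Norm ((p.1 : Site 3) - (p.2 : Site 3)) = 1)
    (p : Λ × Λ) (hp : J p ≠ 0) : (layer p.1 - layer p.2).natAbs ≤ 1 := by
  have h1 := hJnn p hp
  have h2 : (((p.1 : Site 3) - (p.2 : Site 3)) 2).natAbs ≤ l1Norm ((p.1 : Site 3) - (p.2 : Site 3)) := by
    unfold l1Norm
    exact Finset.single_le_sum (f := fun i => (((p.1 : Site 3) - (p.2 : Site 3)) i).natAbs)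
      (fun i _ => Nat.zero_le _) (Finset.mem_univ 2)
  rw [h1, Pi.sub_apply] at h2
  exact h2

/-- **The Lieb–Rivasseau instance used by the layer decoupling**: with `A` = the layers `k, k ± 1` (inside
Hamiltonian = the bonds touching layer `k`), `C = Λ ∖ Λ_k` (outside Hamiltonian = the other bonds) and
`B = A ∩ C = Λ_{k±1}`, the tree's named fact `PlaneRotator.LiebRivasseauInequality` gives, for `a ∈ Λ_k` and
`c ∉ Λ_k`, `⟨cos(θ_a − θ_c)⟩_Λ ≤ ∑_{b ∈ Λ_{k±1}} ⟨cos(θ_a − θ_b)⟩_{A_k} ⟨cos(θ_b − θ_c)⟩_Λ` — hypothesis `hLR` of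
`twoPoint_layered_le_pow_interlayer`. CONDITIONAL on the named fact. [cite: Lieb1980, eq. (23) and notes added in proof (2)] -/
theorem liebRivasseau_layer (h : LiebRivasseauInequality) (hβ : 0 ≤ β) (hp : 0 ≤ Jp) (hz : 0 ≤ Jz)
    (Λ : Finset (Site 3)) (a c : Λ) (hac : layer a ≠ layer c) :
    twoPoint (layeredXYCoupling β Jp Jz Λ) a c ≤
      ∑ b ∈ univ.filter (fun b : Λ => (layer b - layer a).natAbs = 1),
        twoPoint (touching (layeredXYCoupling β Jp Jz Λ) (layer a)) a b *
          twoPoint (layeredXYCoupling β Jp Jz Λ) b c := by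
  set J := layeredXYCoupling β Jp Jz Λ with hJ
  have hJ0 : ∀ p, 0 ≤ J p := layeredXYCoupling_nonneg hβ hp hz Λ
  set k := layer a with hk
  set A : Finset Λ := univ.filter (fun x : Λ => (layer x - k).natAbs ≤ 1) with hA
  set C : Finset Λ := univ.filter (fun x : Λ => layer x ≠ k) with hC
  have hJA0 : ∀ p, 0 ≤ touching J k p := touching_nonneg hJ0 k
  have hJC0 : ∀ p, 0 ≤ untouching J k p := fun p => by
    unfold untouching; split_ifs; exacts [le_rfl, hJ0 p]
  have hsuppA : ∀ p, touching J k p ≠ 0 → p.1 ∈ A ∧ p.2 ∈ A := by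
    intro p hp0
    have hcond : layer p.1 = k ∨ layer p.2 = k := by by_contra hh; exact hp0 (if_neg hh)
    have hJp : J p ≠ 0 := by intro hh; apply hp0; unfold touching; rw [hh, ite_self]
    have hd := natAbs_layer_sub_le_of_nn (layeredXYCoupling_nn Λ) p hJp
    simp only [hA, Finset.mem_filter, Finset.mem_univ, true_and]
    rcases hcond with h1 | h2
    · rw [h1] at hd ⊢
      simp only [sub_self, Int.natAbs_zero, zero_le, true_and]
      omega
    · rw [h2] at hd ⊢
      simp only [sub_self, Int.natAbs_zero, zero_le, and_true]
      exact hd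
  have hsuppC : ∀ p, untouching J k p ≠ 0 → p.1 ∈ C ∧ p.2 ∈ C := by
    intro p hp0
    have hcond : ¬(layer p.1 = k ∨ layer p.2 = k) := by
      intro hh; apply hp0; unfold untouching; rw [if_pos hh]
    push Not at hcond
    simp only [hC, Finset.mem_filter, Finset.mem_univ, true_and]
    exact hcond
  have ha : a ∈ A := by simp [hA, hk]
  have hc : c ∈ C := by simpa [hC, hk] using fun hh => hac hh.symm
  have key := h Λ A C (touching J k) (untouching J k) hJA0 hJC0 hsuppA hsuppC a ha c hc
  rw [touching_add_untouching] at key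
  have hAC : A ∩ C = univ.filter (fun b : Λ => (layer b - layer a).natAbs = 1) := by
    ext b
    simp only [hA, hC, hk, Finset.mem_inter, Finset.mem_filter, Finset.mem_univ, true_and]
    omega
  rwa [hAC] at key

/-- **Layer decoupling for the layered XY model on `ℤ³`, CONDITIONAL only on the tree's named fact
`PlaneRotator.LiebRivasseauInequality`** (Lieb 1980 (23) / Rivasseau 1980): for `β, J∥, J⊥ ≥ 0`, every finite
`Λ ⊂ ℤ³`, every uniform single-layer susceptibility ceiling `χ`
(`∑_{x ∈ Λ_{ℓ(a)}} ⟨cos(θ_a − θ_x)⟩^{2D}_{Λ_{ℓ(a)}} ≤ χ` for all `a`) and all `a, c ∈ Λ`: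

  `⟨cos(θ_a − θ_c)⟩_{Λ,β} ≤ (β J⊥ χ)^{|ℓ(a) − ℓ(c)|}`.

Reading (cell `pub/hubbard-tc`, key I1/K5; INTERLAYER §6 L3): a certified two-dimensional susceptibility ceiling
`χ₂(T)` with `J⊥ χ₂(T) < T` certifies exponential decay across the layers at temperature `T` in every volume —
`k_B T_c^{3D-XY}(J∥, J⊥) ≤ T_×(J⊥) := inf{T : J⊥ χ₂(T) < T}`, the one-sided, theorem-grade form of the quasi-2D
crossover law (`T_× ↓ T_KT` as `J⊥ → 0`). Classical effective model only. [cite: Lieb1980, eq. (23) and notes added in proof (2)] -/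
theorem twoPoint_layered_le_pow_interlayer_of_liebRivasseau (h : LiebRivasseauInequality) (hβ : 0 ≤ β)
    (hp : 0 ≤ Jp) (hz : 0 ≤ Jz) (Λ : Finset (Site 3)) {χ : ℝ}
    (hχ : ∀ a : Λ, ∑ x ∈ univ.filter (fun x : Λ => layer x = layer a),
      twoPoint (inPlane (layeredXYCoupling β Jp Jz Λ) (layer a)) a x ≤ χ)
    (a c : Λ) :
    twoPoint (layeredXYCoupling β Jp Jz Λ) a c ≤ (β * Jz * χ) ^ (layer a - layer c).natAbs :=
  twoPoint_layered_le_pow_interlayer hβ hp hz Λ hχ (fun a' c' hac => liebRivasseau_layer h hβ hp hz Λ a' c' hac) a c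

/-- **Layer decoupling for the layered XY model on `ℤ³` — UNCONDITIONAL.** With the Lieb–Rivasseau inequality now
a theorem of the tree (`liebRivasseauInequality_holds`, `PlaneRotatorLiebRivasseauProof.lean`): for `β, J∥, J⊥ ≥ 0`,
every finite `Λ ⊂ ℤ³` and every uniform single-layer susceptibility ceiling `χ`,
`⟨cos(θ_a − θ_c)⟩_{Λ,β} ≤ (β J⊥ χ)^{|ℓ(a) − ℓ(c)|}` for all `a, c ∈ Λ` — no named-fact hypothesis. (Cell
`pub/hubbard-tc`, key K4-c: class thm-tree.) [cite: Lieb1980, eq. (23) and notes added in proof (2)] -/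
theorem twoPoint_layered_le_pow_interlayer' (hβ : 0 ≤ β) (hp : 0 ≤ Jp) (hz : 0 ≤ Jz) (Λ : Finset (Site 3))
    {χ : ℝ}
    (hχ : ∀ a : Λ, ∑ x ∈ univ.filter (fun x : Λ => layer x = layer a),
      twoPoint (inPlane (layeredXYCoupling β Jp Jz Λ) (layer a)) a x ≤ χ)
    (a c : Λ) :
    twoPoint (layeredXYCoupling β Jp Jz Λ) a c ≤ (β * Jz * χ) ^ (layer a - layer c).natAbs :=
  twoPoint_layered_le_pow_interlayer_of_liebRivasseau liebRivasseauInequality_holds hβ hp hz Λ hχ a c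

end LayeredZ3

end PlaneRotator

end Literature.Probability.LatticeModels

end
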